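/-
Copyright (c) 2026 the pub-hodgecm-mathlib formalisation cell (harness21).  Prover seat hodgecm-mathlib-K2E1b-p01 (g3), Track B «K2-LIT» ∕ h413
(`stmt-HodgeConjecture-24833`), line `K2_E3_EllipticInputs`, unit U3, line U3-d (lead K2E3-p03): FILE C rung C2 — the REGULAR unipotent class.  2026-09-03.
-/
import Summits.HodgeConjecture.HodgeConjecture.Theorems.K2E3CayleyScalingMap          -- ★ p855474 (K2E3-p01): letters `hB`∕`hΨ`, (Z) `comm_iff_comm_cayleyScaling`, (C) `inverseWindow_cayleyScaling`, `coe_conj`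
import Literature.NumberTheory.Automorphic.UnitaryThreeRegularUnipotentClass           -- ★ Prop. 3.9.1 `exists_conj_eq_of_regular_unipotent` (ONE regular unipotent class, `2 ≠ 0`)
import HarnessLib

/-!
# K2_E3 road (h413 = stmt-HodgeConjecture-24833), U3-d FILE C, rung C2 «REGULAR UNIPOTENT CLASS» — part (i): a conjugator `h` with `Ψ u₀ = h u₀ h⁻¹`
# normalising `Z(u₀)`, for EVERY regular unipotent `u₀`, and the choice-free identity `Ad(h) X₀ = s·X₀`

Cell `pub/hodgecm-mathlib` (D-0151), Track B; dealt BY NAME by the U3-d line lead K2E3-p03 (g0) (FILE C SPEC 2026-09-03T22:56Z, dealer K2E3-plan (g1)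
BATCH #3).  TARGET of FILE C per unipotent class: the hypotheses (i) `hΨ`∕`hZ` and (ii) `K hKo hKc ρ hr` of ★ p855453 §1
`K2E3UnipotentOrbitalScalingOfIndex.integral_descConj_indicator_comp_eq_smul_of_conj_of_index`, in the MODEL letters of ★ `K2E3CayleyScalingModel` ∕
★ `K2E3CayleyScalingMap` (K2E3-p01): `K` an ultrametric normed field, `σ : K →+* K`, `M = U(σ, J)(K)`, the eigenvalue ball `B` (`hB`) and the Cayley scaling
`Ψ` (`hΨ`: `mat(Ψ u) = c(s • X_u)`, `X_u = (g − 1)(g + 1)⁻¹`).  THIS RUNG (part (i) of C2, and the algebraic heart of (ii)):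

* §1 (any field, `2 ≠ 0`) **scaled Cayley images of regular unipotents are regular unipotent**: `X_u` is nilpotent with `X_u² ≠ 0` when `g − 1` is nilpotent with
  `(g − 1)² ≠ 0` (`isNilpotent_inverseWindow`, `inverseWindow_sq_ne_zero`: `g − 1 = X_u (g + 1)` with commuting factors); `c(Y) − 1 = 2·Y(1 − Y)⁻¹` is nilpotent with
  non-zero square when `Y` is (`isNilpotent_cayley_sub_one`, `cayley_sub_one_sq_ne_zero`).
* §2 **(i) FOR THE REGULAR CLASS, WITH NO ADAPTED BASIS** (`exists_conj_normalizing_of_regular_unipotent`): for `u₀ ∈ B` regular unipotent, `Ψ u₀` is again a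
  regular unipotent element of `U(σ, J₀)` (§1 + `hΨ`), so ROGAWSKI'S PROPOSITION 3.9.1 (★ `exists_conj_eq_of_regular_unipotent`: ONE regular unipotent class in
  `U(σ, J₀)(K)`, `J₀` the antidiagonal form, `2 ≠ 0` in the field — every residue characteristic) gives `h ∈ U(σ, J₀)` with `Ψ u₀ = h u₀ h⁻¹`; and `h` NORMALISES
  `Z(u₀)` because `Z(Ψ u₀) = Z(u₀)` (★ (Z) `comm_iff_comm_cayleyScaling`).  Output = the letters `hΨ`, `hZ` of ★ p855453 §1 verbatim.
* §3 **`Ad(h) X₀ = s·X₀` for ANY such `h`** (`conj_inverseWindow_eq_smul`: `c⁻¹` is conjugation-equivariant, ★ `inverseWindow_conj`, and `c⁻¹(Ψ u₀) = s·X₀`, ★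
  `inverseWindow_cayleyScaling`) — whence `Ad(h)` acts on `Z(u₀) = {a(1 + βX₀ + γX₀²)}` by `(a, β, γ) ↦ (a, sβ, s²γ)` independently of the choice of `h`
  (`conj_one_add_smul_add_smul_sq`); part (ii) (rung C2-b: the index `[A′ : Ad(h)A′] = [𝒪_F : t𝒪_F]⁶` for `s = t²`, and the Haar identity `hr`) counts on this.

THEOREMS ONLY (no definition ∕ instance ∕ notation ∕ named fact ∕ `sorry`); imports ★ + HarnessLib; lane `--supports stmt-HodgeConjecture-24833 --as helper`.
HONEST LABEL: HC_CM is proved only modulo the 7 printed citations (2 remaining named inputs: hLiu418 = stmt-HodgeConjecture-24832, h413 =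
stmt-HodgeConjecture-24833) until rung 0 closes; count-neutral helper of the U3-d line.

## References
* [Rogawski1990] J. D. Rogawski, *Automorphic Representations of Unitary Groups in Three Variables*, Ann. of Math. Stud. 123 (1990), §3.9 Prop. 3.9.1 p. 32;
  §8.1 Prop. 8.1.2 (b) p. 114.
* [HarishChandra1999AdmissibleDistributions] Harish-Chandra, *Admissible Invariant Distributions on Reductive p-adic Groups*, ULS 16 (1999), §3.1 Lemma 3.2.
* [PlatonovRapinchuk1994] V. Platonov, A. Rapinchuk, *Algebraic Groups and Number Theory* (1994), §3.3.
-/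

set_option autoImplicit false
-- the mandated namespace repeats the single-problem summit's segment (`HodgeConjecture.HodgeConjecture`), as in every `Theorems/*.lean` of this sub-problem
set_option linter.dupNamespace false

noncomputable section

open Filter Topology Polynomial Set
open scoped Matrix MatrixGroups
open Literature.NumberTheory.Automorphic Literature.NumberTheory.Automorphic.UnitaryGroup Literature.NumberTheory.Automorphic.HermitianLattice
open Literature.NumberTheory.Weil1982.UnitaryFinTopForm Literature.LinearAlgebra.Matrix
open Summit.HodgeConjecture.HodgeConjecture.Cruxes.H413.K2E3CayleyScalingAlgebra
open Summit.HodgeConjecture.HodgeConjecture.Cruxes.H413.K2E3CayleyScalingModel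
open Summit.HodgeConjecture.HodgeConjecture.Cruxes.H413.K2E3CayleyScalingMap

namespace Summit.HodgeConjecture.HodgeConjecture.Cruxes.H413.K2E3UnipotentOrbitalScalingRegular

/-! ## §1 Scaled Cayley images of regular unipotent matrices are regular unipotent -/

section Field

variable {K : Type*} [Field K] {n : Type*} [Fintype n] [DecidableEq n]

/-- **`X_g = (g − 1)(g + 1)⁻¹` is nilpotent when `g − 1` is** (`g + 1` invertible; the two factors commute, ★ `nonsing_inv_comm_of_comm`).
[cite: PlatonovRapinchuk1994, §3.3] -/
theorem isNilpotent_inverseWindow {g : Matrix n n K} (hP : IsUnit (g + 1).det) (hnil : IsNilpotent (g - 1)) :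
    IsNilpotent ((g - 1) * (g + 1)⁻¹) := by
  have hc : (g + 1) * (g - 1) = (g - 1) * (g + 1) := by noncomm_ring
  have hcomm : Commute (g - 1) (g + 1)⁻¹ := (nonsing_inv_comm_of_comm hP hc).symm
  exact hcomm.isNilpotent_mul_right hnil

/-- **`X_g² ≠ 0` when `(g − 1)² ≠ 0`**: `g − 1 = X_g·(g + 1)` with `X_g` and `g + 1` commuting, so `(g − 1)² = X_g²·(g + 1)²`. [cite: Rogawski1990, §3.9 p. 32]
[cite: PlatonovRapinchuk1994, §3.3] -/
theorem inverseWindow_sq_ne_zero {g : Matrix n n K} (hP : IsUnit (g + 1).det) (hreg : (g - 1) * (g - 1) ≠ 0) :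
    (g - 1) * (g + 1)⁻¹ * ((g - 1) * (g + 1)⁻¹) ≠ 0 := by
  intro h0
  apply hreg
  have hX : (g - 1) * (g + 1)⁻¹ * (g + 1) = g - 1 := inverseWindow_mul_add_one hP
  have hc : (g + 1) * ((g - 1) * (g + 1)⁻¹) = (g - 1) * (g + 1)⁻¹ * (g + 1) :=
    (inverseWindow_comm_of_comm hP (show g * (g + 1) = (g + 1) * g by noncomm_ring)).symm
  calc (g - 1) * (g - 1) = ((g - 1) * (g + 1)⁻¹ * (g + 1)) * ((g - 1) * (g + 1)⁻¹ * (g + 1)) := by rw [hX]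
    _ = (g - 1) * (g + 1)⁻¹ * ((g + 1) * ((g - 1) * (g + 1)⁻¹)) * (g + 1) := by simp only [Matrix.mul_assoc]
    _ = (g - 1) * (g + 1)⁻¹ * ((g - 1) * (g + 1)⁻¹ * (g + 1)) * (g + 1) := by rw [hc]
    _ = ((g - 1) * (g + 1)⁻¹ * ((g - 1) * (g + 1)⁻¹)) * (g + 1) * (g + 1) := by simp only [Matrix.mul_assoc]
    _ = 0 := by rw [h0, Matrix.zero_mul, Matrix.zero_mul]

/-- **`c(Y) − 1 = 2·Y(1 − Y)⁻¹` is nilpotent when `Y` is** (`det(1 − Y)` a unit; ★ `cayley_sub_one`). [cite: PlatonovRapinchuk1994, §3.3] -/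
theorem isNilpotent_cayley_sub_one {Y : Matrix n n K} (hm : IsUnit (1 - Y).det) (hY : IsNilpotent Y) : IsNilpotent (cayley Y - 1) := by
  rw [cayley_sub_one hm]
  have hc : (1 - Y) * Y = Y * (1 - Y) := by noncomm_ring
  have hcomm : Commute Y (1 - Y)⁻¹ := (nonsing_inv_comm_of_comm hm hc).symm
  exact (hcomm.isNilpotent_mul_right hY).smul (2 : K)

/-- **`(c(Y) − 1)² ≠ 0` when `Y² ≠ 0`** (`2 ≠ 0`, `det(1 − Y)` a unit): `(c(Y) − 1)² = 4·Y²·(1 − Y)⁻²`. [cite: Rogawski1990, §3.9 p. 32] [cite: PlatonovRapinchuk1994, §3.3] -/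
theorem cayley_sub_one_sq_ne_zero (h2 : (2 : K) ≠ 0) {Y : Matrix n n K} (hm : IsUnit (1 - Y).det) (hY2 : Y * Y ≠ 0) :
    (cayley Y - 1) * (cayley Y - 1) ≠ 0 := by
  rw [cayley_sub_one hm]
  intro h0
  apply hY2
  have hc : (1 - Y) * Y = Y * (1 - Y) := by noncomm_ring
  have hinv : (1 - Y)⁻¹ * Y = Y * (1 - Y)⁻¹ := nonsing_inv_comm_of_comm hm hc
  have h1 : (1 - Y)⁻¹ * (1 - Y) = 1 := Matrix.nonsing_inv_mul _ hm
  have hexp : ((2 : K) • (Y * (1 - Y)⁻¹)) * ((2 : K) • (Y * (1 - Y)⁻¹)) = ((2 : K) * 2) • (Y * Y * ((1 - Y)⁻¹ * (1 - Y)⁻¹)) := by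
    rw [Matrix.smul_mul, Matrix.mul_smul, smul_smul]
    congr 1
    calc Y * (1 - Y)⁻¹ * (Y * (1 - Y)⁻¹) = Y * ((1 - Y)⁻¹ * Y) * (1 - Y)⁻¹ := by simp only [Matrix.mul_assoc]
      _ = Y * (Y * (1 - Y)⁻¹) * (1 - Y)⁻¹ := by rw [hinv]
      _ = Y * Y * ((1 - Y)⁻¹ * (1 - Y)⁻¹) := by simp only [Matrix.mul_assoc]
  rw [hexp] at h0
  have h0' : Y * Y * ((1 - Y)⁻¹ * (1 - Y)⁻¹) = 0 := (smul_eq_zero.1 h0).resolve_left (mul_ne_zero h2 h2)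
  have hone : (1 - Y)⁻¹ * (1 - Y)⁻¹ * ((1 - Y) * (1 - Y)) = 1 := by
    calc (1 - Y)⁻¹ * (1 - Y)⁻¹ * ((1 - Y) * (1 - Y)) = (1 - Y)⁻¹ * ((1 - Y)⁻¹ * (1 - Y)) * (1 - Y) := by simp only [Matrix.mul_assoc]
      _ = 1 := by rw [h1, Matrix.mul_one, h1]
  calc Y * Y = Y * Y * ((1 - Y)⁻¹ * (1 - Y)⁻¹ * ((1 - Y) * (1 - Y))) := by rw [hone, Matrix.mul_one]
    _ = (Y * Y * ((1 - Y)⁻¹ * (1 - Y)⁻¹)) * ((1 - Y) * (1 - Y)) := by simp only [Matrix.mul_assoc]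
    _ = 0 := by rw [h0', Matrix.zero_mul]

/-- **Conjugation acts on `1 + βX + γX²` through its action on `X`**: if `hXh⁻¹ = s·X` then `h(a·(1 + β·X + γ·X²))h⁻¹ = a·(1 + (sβ)·X + (s²γ)·X²)` — the
choice-free action of a normalising conjugator on the commutative algebra `K[X]`. [cite: HarishChandra1999AdmissibleDistributions, §3.1 Lemma 3.2]
[cite: Rogawski1990, §8.1 p. 114] -/
theorem conj_one_add_smul_add_smul_sq (x : GL n K) {X : Matrix n n K} {s : K}
    (hx : (x : Matrix n n K) * X * ((x⁻¹ : GL n K) : Matrix n n K) = s • X) (a β γ : K) :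
    (x : Matrix n n K) * (a • (1 + β • X + γ • (X * X))) * ((x⁻¹ : GL n K) : Matrix n n K) =
      a • (1 + (s * β) • X + (s ^ 2 * γ) • (X * X)) := by
  have hxx : ((x⁻¹ : GL n K) : Matrix n n K) * (x : Matrix n n K) = 1 := by rw [← Units.val_mul, inv_mul_cancel, Units.val_one]
  have hx1 : (x : Matrix n n K) * ((x⁻¹ : GL n K) : Matrix n n K) = 1 := by rw [← Units.val_mul, mul_inv_cancel, Units.val_one]
  have hX2 : (x : Matrix n n K) * (X * X) * ((x⁻¹ : GL n K) : Matrix n n K) = (s ^ 2) • (X * X) := by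
    calc (x : Matrix n n K) * (X * X) * ((x⁻¹ : GL n K) : Matrix n n K)
        = ((x : Matrix n n K) * X * ((x⁻¹ : GL n K) : Matrix n n K)) * ((x : Matrix n n K) * X * ((x⁻¹ : GL n K) : Matrix n n K)) := by
          rw [Matrix.mul_assoc ((x : Matrix n n K) * X) ((x⁻¹ : GL n K) : Matrix n n K), ← Matrix.mul_assoc ((x⁻¹ : GL n K) : Matrix n n K),
            ← Matrix.mul_assoc ((x⁻¹ : GL n K) : Matrix n n K), hxx, Matrix.one_mul]
          simp only [Matrix.mul_assoc]
      _ = (s ^ 2) • (X * X) := by rw [hx, Matrix.smul_mul, Matrix.mul_smul, smul_smul, sq]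
  rw [Matrix.mul_smul, Matrix.smul_mul, Matrix.mul_add, Matrix.mul_add, Matrix.add_mul, Matrix.add_mul, Matrix.mul_one, hx1,
    Matrix.mul_smul, Matrix.smul_mul, hx, Matrix.mul_smul, Matrix.smul_mul, hX2, smul_smul, smul_smul, mul_comm β s, mul_comm γ (s ^ 2)]

end Field

/-! ## §2 (i) for the regular class: a conjugator, normalising the centraliser — Rogawski's Proposition 3.9.1 -/

section Model

variable {K : Type*} [NormedField K] [IsUltrametricDist K] (σ : K →+* K) (J : Matrix (Fin 3) (Fin 3) K) {ρ : ℝ} {s : K}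
  {B : Set ↥(unitaryGroupOfForm σ J)}
  (hB : ∀ u : ↥(unitaryGroupOfForm σ J), u ∈ B ↔
    IsUnit (((u : GL (Fin 3) K) : Matrix (Fin 3) (Fin 3) K) + 1).det ∧
    ‖((((u : GL (Fin 3) K) : Matrix (Fin 3) (Fin 3) K) - 1) * (((u : GL (Fin 3) K) : Matrix (Fin 3) (Fin 3) K) + 1)⁻¹).charpoly.coeff 2‖ ≤ ρ ∧
    ‖((((u : GL (Fin 3) K) : Matrix (Fin 3) (Fin 3) K) - 1) * (((u : GL (Fin 3) K) : Matrix (Fin 3) (Fin 3) K) + 1)⁻¹).charpoly.coeff 1‖ ≤ ρ ^ 2 ∧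
    ‖((((u : GL (Fin 3) K) : Matrix (Fin 3) (Fin 3) K) - 1) * (((u : GL (Fin 3) K) : Matrix (Fin 3) (Fin 3) K) + 1)⁻¹).charpoly.coeff 0‖ ≤ ρ ^ 3)
  {Ψ : ↥(unitaryGroupOfForm σ J) → ↥(unitaryGroupOfForm σ J)}
  (hΨ : ∀ u ∈ B,
    (((Ψ u : ↥(unitaryGroupOfForm σ J)) : GL (Fin 3) K) : Matrix (Fin 3) (Fin 3) K) =
        cayley (s • ((((u : GL (Fin 3) K) : Matrix (Fin 3) (Fin 3) K) - 1) * (((u : GL (Fin 3) K) : Matrix (Fin 3) (Fin 3) K) + 1)⁻¹)) ∧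
    ((((Ψ u : ↥(unitaryGroupOfForm σ J)) : GL (Fin 3) K)⁻¹ : GL (Fin 3) K) : Matrix (Fin 3) (Fin 3) K) =
        cayley (-(s • ((((u : GL (Fin 3) K) : Matrix (Fin 3) (Fin 3) K) - 1) * (((u : GL (Fin 3) K) : Matrix (Fin 3) (Fin 3) K) + 1)⁻¹))))

include hB hΨ in
/-- **`Ψ` of a regular unipotent is regular unipotent** (`u₀ ∈ B` with `g − 1` nilpotent, `(g − 1)² ≠ 0`; `2 ≠ 0`, `s ≠ 0`, `‖s‖ρ < 1`): `mat(Ψ u₀) − 1 = c(s·X₀) − 1` is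
nilpotent with non-zero square (§1). [cite: Rogawski1990, §3.9 p. 32] [cite: PlatonovRapinchuk1994, §3.3] -/
theorem cayleyScaling_regular_unipotent (h2 : (2 : K) ≠ 0) (hs0 : s ≠ 0) (hsρ : ‖s‖ * ρ < 1) {u₀ : ↥(unitaryGroupOfForm σ J)} (hu₀ : u₀ ∈ B)
    (hnil : IsNilpotent (((u₀ : GL (Fin 3) K) : Matrix (Fin 3) (Fin 3) K) - 1))
    (hreg : (((u₀ : GL (Fin 3) K) : Matrix (Fin 3) (Fin 3) K) - 1) * (((u₀ : GL (Fin 3) K) : Matrix (Fin 3) (Fin 3) K) - 1) ≠ 0) :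
    IsNilpotent ((((Ψ u₀ : ↥(unitaryGroupOfForm σ J)) : GL (Fin 3) K) : Matrix (Fin 3) (Fin 3) K) - 1) ∧
    ((((Ψ u₀ : ↥(unitaryGroupOfForm σ J)) : GL (Fin 3) K) : Matrix (Fin 3) (Fin 3) K) - 1) *
      ((((Ψ u₀ : ↥(unitaryGroupOfForm σ J)) : GL (Fin 3) K) : Matrix (Fin 3) (Fin 3) K) - 1) ≠ 0 := by
  obtain ⟨hP, hm, -⟩ := isUnit_of_mem_ball σ J hB hsρ hu₀
  rw [(hΨ u₀ hu₀).1]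
  have hXnil := isNilpotent_inverseWindow hP hnil
  have hX2 := inverseWindow_sq_ne_zero hP hreg
  refine ⟨isNilpotent_cayley_sub_one hm (hXnil.smul s), cayley_sub_one_sq_ne_zero h2 hm ?_⟩
  rw [Matrix.smul_mul, Matrix.mul_smul, smul_smul]
  exact smul_ne_zero (mul_ne_zero hs0 hs0) hX2

include hB hΨ in
/-- **(i) FOR THE REGULAR UNIPOTENT CLASS — A CONJUGATOR `h` WITH `Ψ u₀ = h u₀ h⁻¹` NORMALISING `Z(u₀)`, for EVERY regular unipotent `u₀ ∈ B`** (the letters `hΨ`,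
`hZ` of ★ `K2E3UnipotentOrbitalScalingOfIndex.integral_descConj_indicator_comp_eq_smul_of_conj_of_index`), on the antidiagonal model `U(σ, J₀)(K)`, `σ` an involution,
`2 ≠ 0`, `s ≠ 0`, `‖s‖ρ < 1`: `Ψ u₀` is regular unipotent (`cayleyScaling_regular_unipotent`), so PROPOSITION 3.9.1 (★ `exists_conj_eq_of_regular_unipotent`: the regular
unipotents of `U(σ, J₀)(K)` form ONE conjugacy class) gives `h`; it normalises `Z(u₀)` since `Z(Ψ u₀) = Z(u₀)` (★ (Z) `comm_iff_comm_cayleyScaling`).  No adapted basis, no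
root-group equation, every residue characteristic. [cite: Rogawski1990, §3.9 Prop. 3.9.1 p. 32; §8.1 Prop. 8.1.2 (b) p. 114]
[cite: HarishChandra1999AdmissibleDistributions, §3.1 Lemma 3.2] -/
theorem exists_conj_normalizing_of_regular_unipotent (hJ : J = (StdForm.antidiagonal 3).over K) (hσ : ∀ z : K, σ (σ z) = z)
    (h2 : (2 : K) ≠ 0) (hs0 : s ≠ 0) (hsρ : ‖s‖ * ρ < 1) {u₀ : ↥(unitaryGroupOfForm σ J)} (hu₀ : u₀ ∈ B)
    (hnil : IsNilpotent (((u₀ : GL (Fin 3) K) : Matrix (Fin 3) (Fin 3) K) - 1))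
    (hreg : (((u₀ : GL (Fin 3) K) : Matrix (Fin 3) (Fin 3) K) - 1) * (((u₀ : GL (Fin 3) K) : Matrix (Fin 3) (Fin 3) K) - 1) ≠ 0) :
    ∃ h : ↥(unitaryGroupOfForm σ J), Ψ u₀ = h * u₀ * h⁻¹ ∧
      ∀ z : ↥(unitaryGroupOfForm σ J), z ∈ Subgroup.centralizer ({u₀} : Set ↥(unitaryGroupOfForm σ J)) ↔
        h * z * h⁻¹ ∈ Subgroup.centralizer ({u₀} : Set ↥(unitaryGroupOfForm σ J)) := by
  obtain ⟨hnil', hreg'⟩ := cayleyScaling_regular_unipotent σ J hB hΨ h2 hs0 hsρ hu₀ hnil hreg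
  subst hJ
  obtain ⟨k, hk, hku⟩ := exists_conj_eq_of_regular_unipotent σ hσ h2 u₀.2 (Ψ u₀).2 hnil hnil' hreg hreg'
  have hconj : Ψ u₀ = ⟨k, hk⟩ * u₀ * ⟨k, hk⟩⁻¹ := Subtype.ext hku.symm
  refine ⟨⟨k, hk⟩, hconj, fun z => ?_⟩
  rw [Subgroup.mem_centralizer_singleton_iff, Subgroup.mem_centralizer_singleton_iff,
    comm_iff_comm_cayleyScaling σ _ hB hΨ h2 hs0 hsρ hu₀ (⟨k, hk⟩ * z * ⟨k, hk⟩⁻¹), hconj]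
  constructor
  · intro hzu
    calc ⟨k, hk⟩ * z * ⟨k, hk⟩⁻¹ * (⟨k, hk⟩ * u₀ * ⟨k, hk⟩⁻¹) = ⟨k, hk⟩ * (z * u₀) * ⟨k, hk⟩⁻¹ := by group
      _ = ⟨k, hk⟩ * (u₀ * z) * ⟨k, hk⟩⁻¹ := by rw [hzu]
      _ = ⟨k, hk⟩ * u₀ * ⟨k, hk⟩⁻¹ * (⟨k, hk⟩ * z * ⟨k, hk⟩⁻¹) := by group
  · intro H
    calc z * u₀ = (⟨k, hk⟩ : ↥(unitaryGroupOfForm σ ((StdForm.antidiagonal 3).over K)))⁻¹ *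
          (⟨k, hk⟩ * z * ⟨k, hk⟩⁻¹ * (⟨k, hk⟩ * u₀ * ⟨k, hk⟩⁻¹)) * ⟨k, hk⟩ := by group
      _ = (⟨k, hk⟩ : ↥(unitaryGroupOfForm σ ((StdForm.antidiagonal 3).over K)))⁻¹ *
          (⟨k, hk⟩ * u₀ * ⟨k, hk⟩⁻¹ * (⟨k, hk⟩ * z * ⟨k, hk⟩⁻¹)) * ⟨k, hk⟩ := by rw [H]
      _ = u₀ * z := by group

/-! ## §3 `Ad(h) X₀ = s·X₀` for ANY conjugator `h` with `Ψ u₀ = h u₀ h⁻¹` -/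

include hB hΨ in
/-- **`Ad(h) X₀ = s·X₀`** whenever `Ψ u₀ = h u₀ h⁻¹` (`u₀ ∈ B`, `2 ≠ 0`, `‖s‖ρ < 1`): `h X₀ h⁻¹ = c⁻¹(h u₀ h⁻¹) = c⁻¹(Ψ u₀) = s·X₀` (★ `inverseWindow_conj`, ★
`inverseWindow_cayleyScaling`).  Consequently `Ad(h)` acts on the commutative algebra `K[X₀] ⊇ Z(u₀)` by `X₀ ↦ sX₀` — independently of the choice of `h`
(`conj_one_add_smul_add_smul_sq`). [cite: HarishChandra1999AdmissibleDistributions, §3.1 Lemma 3.2] [cite: PlatonovRapinchuk1994, §3.3] -/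
theorem conj_inverseWindow_eq_smul (h2 : (2 : K) ≠ 0) (hsρ : ‖s‖ * ρ < 1) {u₀ h : ↥(unitaryGroupOfForm σ J)} (hu₀ : u₀ ∈ B)
    (hconj : Ψ u₀ = h * u₀ * h⁻¹) :
    ((h : GL (Fin 3) K) : Matrix (Fin 3) (Fin 3) K) *
        ((((u₀ : GL (Fin 3) K) : Matrix (Fin 3) (Fin 3) K) - 1) * (((u₀ : GL (Fin 3) K) : Matrix (Fin 3) (Fin 3) K) + 1)⁻¹) *
        (((h : GL (Fin 3) K)⁻¹ : GL (Fin 3) K) : Matrix (Fin 3) (Fin 3) K) =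
      s • ((((u₀ : GL (Fin 3) K) : Matrix (Fin 3) (Fin 3) K) - 1) * (((u₀ : GL (Fin 3) K) : Matrix (Fin 3) (Fin 3) K) + 1)⁻¹) := by
  obtain ⟨hP, -, -⟩ := isUnit_of_mem_ball σ J hB hsρ hu₀
  obtain ⟨-, hX⟩ := inverseWindow_cayleyScaling σ J hB hΨ h2 hsρ hu₀
  rw [← hX, hconj, coe_conj, inverseWindow_conj (h : GL (Fin 3) K) hP]

include hB hΨ in
/-- **The action of a normalising conjugator on `K[X₀]`**: if `Ψ u₀ = h u₀ h⁻¹` then `h · a(1 + βX₀ + γX₀²) · h⁻¹ = a(1 + sβ·X₀ + s²γ·X₀²)` — so on the centraliser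
`Z(u₀) = Z(X₀) ⊆ K[X₀]` of a REGULAR unipotent `u₀`, `Ad(h)` is the weight map `(a, β, γ) ↦ (a, sβ, s²γ)` whatever `h` (rung C2-b counts its index on an integral box).
[cite: HarishChandra1999AdmissibleDistributions, §3.1 Lemma 3.2] [cite: Rogawski1990, §8.1 Prop. 8.1.2 (b) p. 114] -/
theorem conj_centralizerElt_eq (h2 : (2 : K) ≠ 0) (hsρ : ‖s‖ * ρ < 1) {u₀ h : ↥(unitaryGroupOfForm σ J)} (hu₀ : u₀ ∈ B)
    (hconj : Ψ u₀ = h * u₀ * h⁻¹) (a β γ : K) :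
    ((h : GL (Fin 3) K) : Matrix (Fin 3) (Fin 3) K) *
        (a • (1 + β • ((((u₀ : GL (Fin 3) K) : Matrix (Fin 3) (Fin 3) K) - 1) * (((u₀ : GL (Fin 3) K) : Matrix (Fin 3) (Fin 3) K) + 1)⁻¹) +
          γ • (((((u₀ : GL (Fin 3) K) : Matrix (Fin 3) (Fin 3) K) - 1) * (((u₀ : GL (Fin 3) K) : Matrix (Fin 3) (Fin 3) K) + 1)⁻¹) *
            ((((u₀ : GL (Fin 3) K) : Matrix (Fin 3) (Fin 3) K) - 1) * (((u₀ : GL (Fin 3) K) : Matrix (Fin 3) (Fin 3) K) + 1)⁻¹)))) *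
        (((h : GL (Fin 3) K)⁻¹ : GL (Fin 3) K) : Matrix (Fin 3) (Fin 3) K) =
      a • (1 + (s * β) • ((((u₀ : GL (Fin 3) K) : Matrix (Fin 3) (Fin 3) K) - 1) * (((u₀ : GL (Fin 3) K) : Matrix (Fin 3) (Fin 3) K) + 1)⁻¹) +
        (s ^ 2 * γ) • (((((u₀ : GL (Fin 3) K) : Matrix (Fin 3) (Fin 3) K) - 1) * (((u₀ : GL (Fin 3) K) : Matrix (Fin 3) (Fin 3) K) + 1)⁻¹) *
          ((((u₀ : GL (Fin 3) K) : Matrix (Fin 3) (Fin 3) K) - 1) * (((u₀ : GL (Fin 3) K) : Matrix (Fin 3) (Fin 3) K) + 1)⁻¹))) :=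
  conj_one_add_smul_add_smul_sq (h : GL (Fin 3) K) (conj_inverseWindow_eq_smul σ J hB hΨ h2 hsρ hu₀ hconj) a β γ

end Model

/-! ## §4 (EDITION 2, append-only) The Ψ-free form of (i) — the line lead's FINAL model-level letters (K2E3-p03, 2026-09-03T23:06Z)

For a UNIPOTENT `u₀` no eigenvalue ball and no `Ψ` are needed: `g + 1 = 2·(unipotent)` and `1 ± s·X` are unipotent, hence invertible, outright; `c(s·X)` is
unitary because `s·X` is skew (★ `transpose_map_inverseWindow_add_eq_zero`, ★ `skew_smul_of_fixed`, ★ `transpose_map_cayley_mul_mul_cayley`).  So over ANY field with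
`2 ≠ 0` (no norm, no valuation): for every regular unipotent `u₀ ∈ U(σ, J₀)(K)` and every `σ`-fixed `s ≠ 0` there is `h ∈ U(σ, J₀)(K)` with
`mat(h u₀ h⁻¹) = c(s · X_{u₀})` normalising `Z(u₀)` — the letters (i′) of the assembly `K2E3UnipotentOrbitalScalingLaw` (with `s := t·t`). -/

section PsiFree

variable {K : Type*} [Field K] (σ : K →+* K)

/-- **`Z(c(s·X_g)) = Z(g)`, Ψ-free**: for `g ∈ GL₃` with `g + 1` invertible, `2 ≠ 0`, `s ≠ 0` and `det(1 − s·X_g)` a unit, a matrix commutes with `g` iff it commutes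
with `c(s·X_g)` (★ `inverseWindow_comm_of_comm`, ★ `cayley_comm_of_comm`, ★ `inverseWindow_cayley`, ★ `cayley_inverseWindow` — the argument of ★ (Z)
`comm_iff_comm_cayleyScaling` without the ball). [cite: PlatonovRapinchuk1994, §3.3] [cite: Rogawski1990, §3.1 p. 19] -/
theorem comm_iff_comm_cayley_smul_inverseWindow (h2 : (2 : K) ≠ 0) {s : K} (hs0 : s ≠ 0) {g z : Matrix (Fin 3) (Fin 3) K}
    (hP : IsUnit (g + 1).det) (hm : IsUnit (1 - s • ((g - 1) * (g + 1)⁻¹)).det) :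
    z * g = g * z ↔ z * cayley (s • ((g - 1) * (g + 1)⁻¹)) = cayley (s • ((g - 1) * (g + 1)⁻¹)) * z := by
  have h2u : IsUnit (2 : K) := isUnit_iff_ne_zero.2 h2
  obtain ⟨hm₀, hcay₀⟩ := cayley_inverseWindow h2u hP
  constructor
  · intro hzg
    have hX : (g - 1) * (g + 1)⁻¹ * z = z * ((g - 1) * (g + 1)⁻¹) := inverseWindow_comm_of_comm hP hzg.symm
    have hsX : s • ((g - 1) * (g + 1)⁻¹) * z = z * (s • ((g - 1) * (g + 1)⁻¹)) := by rw [Matrix.smul_mul, Matrix.mul_smul, hX]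
    exact (cayley_comm_of_comm hm hsX).symm
  · intro hzc
    have hP' : IsUnit (cayley (s • ((g - 1) * (g + 1)⁻¹)) + 1).det := isUnit_det_cayley_add_one h2u hm
    have h1 := inverseWindow_comm_of_comm hP' hzc.symm
    rw [inverseWindow_cayley h2u hm, Matrix.smul_mul, Matrix.mul_smul] at h1
    have hX : (g - 1) * (g + 1)⁻¹ * z = z * ((g - 1) * (g + 1)⁻¹) := smul_right_injective (Matrix (Fin 3) (Fin 3) K) hs0 h1
    have h3 := cayley_comm_of_comm hm₀ hX
    rw [hcay₀] at h3
    exact h3.symm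

/-- Two elements of `U(σ, J)(K)` commute iff their matrices do (field-level twin of ★ `commute_iff_coe`). [folklore] -/
theorem commute_iff_coe_coe {J : Matrix (Fin 3) (Fin 3) K} (z u : ↥(unitaryGroupOfForm σ J)) :
    z * u = u * z ↔ ((z : GL (Fin 3) K) : Matrix (Fin 3) (Fin 3) K) * ((u : GL (Fin 3) K) : Matrix (Fin 3) (Fin 3) K) =
      ((u : GL (Fin 3) K) : Matrix (Fin 3) (Fin 3) K) * ((z : GL (Fin 3) K) : Matrix (Fin 3) (Fin 3) K) := by
  have hzu : (((z * u : ↥(unitaryGroupOfForm σ J)) : GL (Fin 3) K) : Matrix (Fin 3) (Fin 3) K) =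
      ((z : GL (Fin 3) K) : Matrix (Fin 3) (Fin 3) K) * ((u : GL (Fin 3) K) : Matrix (Fin 3) (Fin 3) K) := by
    simp only [Subgroup.coe_mul, Units.val_mul]
  have huz : (((u * z : ↥(unitaryGroupOfForm σ J)) : GL (Fin 3) K) : Matrix (Fin 3) (Fin 3) K) =
      ((u : GL (Fin 3) K) : Matrix (Fin 3) (Fin 3) K) * ((z : GL (Fin 3) K) : Matrix (Fin 3) (Fin 3) K) := by
    simp only [Subgroup.coe_mul, Units.val_mul]
  rw [← hzu, ← huz]
  exact ⟨fun h => by rw [h], fun h => Subtype.ext (Units.ext h)⟩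

/-- **`det(g + 1)` is a unit for unipotent `g`** (`2 ≠ 0`): `g + 1 = 2·(1 + 2⁻¹(g − 1))` with `2⁻¹(g − 1)` nilpotent. [cite: PlatonovRapinchuk1994, §3.3] -/
theorem isUnit_det_add_one_of_isNilpotent (h2 : (2 : K) ≠ 0) {n : Type*} [Fintype n] [DecidableEq n] {g : Matrix n n K}
    (hnil : IsNilpotent (g - 1)) : IsUnit (g + 1).det := by
  have hA : IsUnit (1 + (2⁻¹ : K) • (g - 1)) := (hnil.smul (2⁻¹ : K)).isUnit_one_add
  have hg1 : g + 1 = (2 : K) • (1 + (2⁻¹ : K) • (g - 1)) := by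
    rw [smul_add, smul_smul, mul_inv_cancel₀ h2, one_smul, two_smul]; abel
  rw [hg1, Matrix.det_smul]
  exact ((isUnit_iff_ne_zero.2 h2).pow _).mul ((Matrix.isUnit_iff_isUnit_det _).1 hA)

/-- **The normalising clause, Ψ-free**: if `mat(h u₀ h⁻¹) = c(s·X_{u₀})` (`u₀` unipotent, `2 ≠ 0`, `s ≠ 0`) then `z ∈ Z(u₀) ↔ h z h⁻¹ ∈ Z(u₀)` — because
`Z(c(s·X_{u₀})) = Z(u₀)` (`comm_iff_comm_cayley_smul_inverseWindow`) and `Z(h u₀ h⁻¹) = h Z(u₀) h⁻¹`. (= the letter `hZ` of ★ p855453 §1.)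
[cite: HarishChandra1999AdmissibleDistributions, §3.1 Lemma 3.2] [cite: PlatonovRapinchuk1994, §3.3] -/
theorem mem_centralizer_iff_conj_mem_of_coe_conj_eq (h2 : (2 : K) ≠ 0) {s : K} (hs0 : s ≠ 0) {J : Matrix (Fin 3) (Fin 3) K}
    {u₀ h : ↥(unitaryGroupOfForm σ J)} (hnil : IsNilpotent (((u₀ : GL (Fin 3) K) : Matrix (Fin 3) (Fin 3) K) - 1))
    (hmat : (((h * u₀ * h⁻¹ : ↥(unitaryGroupOfForm σ J)) : GL (Fin 3) K) : Matrix (Fin 3) (Fin 3) K) =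
      cayley (s • ((((u₀ : GL (Fin 3) K) : Matrix (Fin 3) (Fin 3) K) - 1) * (((u₀ : GL (Fin 3) K) : Matrix (Fin 3) (Fin 3) K) + 1)⁻¹)))
    (z : ↥(unitaryGroupOfForm σ J)) :
    z ∈ Subgroup.centralizer ({u₀} : Set ↥(unitaryGroupOfForm σ J)) ↔ h * z * h⁻¹ ∈ Subgroup.centralizer ({u₀} : Set ↥(unitaryGroupOfForm σ J)) := by
  have hP : IsUnit ((((u₀ : GL (Fin 3) K) : Matrix (Fin 3) (Fin 3) K)) + 1).det := isUnit_det_add_one_of_isNilpotent h2 hnil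
  have hm : IsUnit (1 - s • ((((u₀ : GL (Fin 3) K) : Matrix (Fin 3) (Fin 3) K) - 1) * (((u₀ : GL (Fin 3) K) : Matrix (Fin 3) (Fin 3) K) + 1)⁻¹)).det :=
    (Matrix.isUnit_iff_isUnit_det _).1 ((isNilpotent_inverseWindow hP hnil).smul s).isUnit_one_sub
  have hZ : ∀ w : ↥(unitaryGroupOfForm σ J), w * u₀ = u₀ * w ↔ w * (h * u₀ * h⁻¹) = (h * u₀ * h⁻¹) * w := fun w => by
    rw [commute_iff_coe_coe, commute_iff_coe_coe, hmat]
    exact comm_iff_comm_cayley_smul_inverseWindow h2 hs0 hP hm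
  rw [Subgroup.mem_centralizer_singleton_iff, Subgroup.mem_centralizer_singleton_iff, hZ (h * z * h⁻¹)]
  constructor
  · intro hzu
    calc h * z * h⁻¹ * (h * u₀ * h⁻¹) = h * (z * u₀) * h⁻¹ := by group
      _ = h * (u₀ * z) * h⁻¹ := by rw [hzu]
      _ = h * u₀ * h⁻¹ * (h * z * h⁻¹) := by group
  · intro H
    calc z * u₀ = h⁻¹ * (h * z * h⁻¹ * (h * u₀ * h⁻¹)) * h := by group
      _ = h⁻¹ * (h * u₀ * h⁻¹ * (h * z * h⁻¹)) * h := by rw [H]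
      _ = u₀ * z := by group

/-- **(i′) FOR THE REGULAR UNIPOTENT CLASS, Ψ-FREE** (the line lead's final model letters): `K` any field with `2 ≠ 0`, `σ` an involution, `J₀` the antidiagonal
form, `s` a `σ`-fixed non-zero scalar; for every `u₀ ∈ U(σ, J₀)(K)` with `(mat u₀ − 1)³ = 0` and `(mat u₀ − 1)² ≠ 0` there is `h ∈ U(σ, J₀)(K)` with
**`mat(h u₀ h⁻¹) = c(s · X)`**, `X = (mat u₀ − 1)(mat u₀ + 1)⁻¹`, and **`z ∈ Z(u₀) ↔ h z h⁻¹ ∈ Z(u₀)`**.  PROOF: `1 ± s·X` are unipotent hence invertible, `s·X` is skew, so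
`c(s·X)` is an element of `U(σ, J₀)` (★ `cayleyGL`); it is regular unipotent (§1); PROPOSITION 3.9.1 (★ `exists_conj_eq_of_regular_unipotent`) conjugates `u₀` to it;
the normalising clause is `mem_centralizer_iff_conj_mem_of_coe_conj_eq`. [cite: Rogawski1990, §3.9 Prop. 3.9.1 p. 32; §8.1 Prop. 8.1.2 (b) p. 114]
[cite: HarishChandra1999AdmissibleDistributions, §3.1 Lemma 3.2] [cite: PlatonovRapinchuk1994, §3.3] -/
theorem exists_conj_coe_eq_cayley_smul_of_regular_unipotent (hσ : ∀ z : K, σ (σ z) = z) (h2 : (2 : K) ≠ 0) {s : K} (hσs : σ s = s) (hs0 : s ≠ 0)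
    (u₀ : ↥(unitaryGroupOfForm σ ((StdForm.antidiagonal 3).over K)))
    (h3 : (((u₀ : GL (Fin 3) K) : Matrix (Fin 3) (Fin 3) K) - 1) ^ 3 = 0)
    (hreg : (((u₀ : GL (Fin 3) K) : Matrix (Fin 3) (Fin 3) K) - 1) ^ 2 ≠ 0) :
    ∃ h : ↥(unitaryGroupOfForm σ ((StdForm.antidiagonal 3).over K)),
      (((h * u₀ * h⁻¹ : ↥(unitaryGroupOfForm σ ((StdForm.antidiagonal 3).over K))) : GL (Fin 3) K) : Matrix (Fin 3) (Fin 3) K) = cayley (s • ((((u₀ : GL (Fin 3) K) : Matrix (Fin 3) (Fin 3) K) - 1) * (((u₀ : GL (Fin 3) K) : Matrix (Fin 3) (Fin 3) K) + 1)⁻¹)) ∧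
      ∀ z : ↥(unitaryGroupOfForm σ ((StdForm.antidiagonal 3).over K)),
        z ∈ Subgroup.centralizer ({u₀} : Set ↥(unitaryGroupOfForm σ ((StdForm.antidiagonal 3).over K))) ↔ h * z * h⁻¹ ∈ Subgroup.centralizer ({u₀} : Set ↥(unitaryGroupOfForm σ ((StdForm.antidiagonal 3).over K))) := by
  have hnil : IsNilpotent (((u₀ : GL (Fin 3) K) : Matrix (Fin 3) (Fin 3) K) - 1) := ⟨3, h3⟩
  have hreg' : (((u₀ : GL (Fin 3) K) : Matrix (Fin 3) (Fin 3) K) - 1) * (((u₀ : GL (Fin 3) K) : Matrix (Fin 3) (Fin 3) K) - 1) ≠ 0 := by rwa [← sq]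
  have hP : IsUnit (((u₀ : GL (Fin 3) K) : Matrix (Fin 3) (Fin 3) K) + 1).det := isUnit_det_add_one_of_isNilpotent h2 hnil
  have hXnil : IsNilpotent ((((u₀ : GL (Fin 3) K) : Matrix (Fin 3) (Fin 3) K) - 1) * (((u₀ : GL (Fin 3) K) : Matrix (Fin 3) (Fin 3) K) + 1)⁻¹) := isNilpotent_inverseWindow hP hnil
  have hX2 : ((((u₀ : GL (Fin 3) K) : Matrix (Fin 3) (Fin 3) K) - 1) * (((u₀ : GL (Fin 3) K) : Matrix (Fin 3) (Fin 3) K) + 1)⁻¹) * ((((u₀ : GL (Fin 3) K) : Matrix (Fin 3) (Fin 3) K) - 1) * (((u₀ : GL (Fin 3) K) : Matrix (Fin 3) (Fin 3) K) + 1)⁻¹) ≠ 0 := inverseWindow_sq_ne_zero hP hreg'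
  have hm : IsUnit (1 - s • ((((u₀ : GL (Fin 3) K) : Matrix (Fin 3) (Fin 3) K) - 1) * (((u₀ : GL (Fin 3) K) : Matrix (Fin 3) (Fin 3) K) + 1)⁻¹)).det := (Matrix.isUnit_iff_isUnit_det _).1 (hXnil.smul s).isUnit_one_sub
  have hp : IsUnit (1 + s • ((((u₀ : GL (Fin 3) K) : Matrix (Fin 3) (Fin 3) K) - 1) * (((u₀ : GL (Fin 3) K) : Matrix (Fin 3) (Fin 3) K) + 1)⁻¹)).det := (Matrix.isUnit_iff_isUnit_det _).1 (hXnil.smul s).isUnit_one_add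
  have hskew : ((s • ((((u₀ : GL (Fin 3) K) : Matrix (Fin 3) (Fin 3) K) - 1) * (((u₀ : GL (Fin 3) K) : Matrix (Fin 3) (Fin 3) K) + 1)⁻¹)).map σ)ᵀ * (StdForm.antidiagonal 3).over K + (StdForm.antidiagonal 3).over K * (s • ((((u₀ : GL (Fin 3) K) : Matrix (Fin 3) (Fin 3) K) - 1) * (((u₀ : GL (Fin 3) K) : Matrix (Fin 3) (Fin 3) K) + 1)⁻¹)) = 0 :=
    K2E3CompactCartanRegularRay.skew_smul_of_fixed σ (transpose_map_inverseWindow_add_eq_zero σ (mem_unitaryGroupOfForm_iff.1 u₀.2) hP) hσs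
  have hmem : cayleyGL (s • ((((u₀ : GL (Fin 3) K) : Matrix (Fin 3) (Fin 3) K) - 1) * (((u₀ : GL (Fin 3) K) : Matrix (Fin 3) (Fin 3) K) + 1)⁻¹)) hm hp ∈ unitaryGroupOfForm σ ((StdForm.antidiagonal 3).over K) :=
    mem_unitaryGroupOfForm_iff.2 (transpose_map_cayley_mul_mul_cayley σ hm hskew)
  have hnil' : IsNilpotent (((cayleyGL (s • ((((u₀ : GL (Fin 3) K) : Matrix (Fin 3) (Fin 3) K) - 1) * (((u₀ : GL (Fin 3) K) : Matrix (Fin 3) (Fin 3) K) + 1)⁻¹)) hm hp : GL (Fin 3) K) : Matrix (Fin 3) (Fin 3) K) - 1) := by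
    rw [coe_cayleyGL]; exact isNilpotent_cayley_sub_one hm (hXnil.smul s)
  have hreg'' : (((cayleyGL (s • ((((u₀ : GL (Fin 3) K) : Matrix (Fin 3) (Fin 3) K) - 1) * (((u₀ : GL (Fin 3) K) : Matrix (Fin 3) (Fin 3) K) + 1)⁻¹)) hm hp : GL (Fin 3) K) : Matrix (Fin 3) (Fin 3) K) - 1) *
      (((cayleyGL (s • ((((u₀ : GL (Fin 3) K) : Matrix (Fin 3) (Fin 3) K) - 1) * (((u₀ : GL (Fin 3) K) : Matrix (Fin 3) (Fin 3) K) + 1)⁻¹)) hm hp : GL (Fin 3) K) : Matrix (Fin 3) (Fin 3) K) - 1) ≠ 0 := by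
    rw [coe_cayleyGL]
    refine cayley_sub_one_sq_ne_zero h2 hm ?_
    rw [Matrix.smul_mul, Matrix.mul_smul, smul_smul]
    exact smul_ne_zero (mul_ne_zero hs0 hs0) hX2
  obtain ⟨k, hk, hku⟩ := exists_conj_eq_of_regular_unipotent σ hσ h2 u₀.2 hmem hnil hnil' hreg' hreg''
  have hmat : (((⟨k, hk⟩ * u₀ * ⟨k, hk⟩⁻¹ : ↥(unitaryGroupOfForm σ ((StdForm.antidiagonal 3).over K))) : GL (Fin 3) K) : Matrix (Fin 3) (Fin 3) K) = cayley (s • ((((u₀ : GL (Fin 3) K) : Matrix (Fin 3) (Fin 3) K) - 1) * (((u₀ : GL (Fin 3) K) : Matrix (Fin 3) (Fin 3) K) + 1)⁻¹)) := by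
    have e1 : ((⟨k, hk⟩ * u₀ * ⟨k, hk⟩⁻¹ : ↥(unitaryGroupOfForm σ ((StdForm.antidiagonal 3).over K))) : GL (Fin 3) K) = k * (u₀ : GL (Fin 3) K) * k⁻¹ := rfl
    rw [e1, hku, coe_cayleyGL]
  exact ⟨⟨k, hk⟩, hmat, mem_centralizer_iff_conj_mem_of_coe_conj_eq σ h2 hs0 hnil hmat⟩

/-- **`Ad(h) X = s·X` for every `h` with `mat(h u₀ h⁻¹) = c(s·X)`, Ψ-free** (`2 ≠ 0`, `mat u₀ − 1` nilpotent): `h X h⁻¹ = c⁻¹(h u₀ h⁻¹) = c⁻¹(c(s·X)) = s·X`.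
[cite: HarishChandra1999AdmissibleDistributions, §3.1 Lemma 3.2] [cite: PlatonovRapinchuk1994, §3.3] -/
theorem conj_inverseWindow_eq_smul_of_coe_conj_eq (h2 : (2 : K) ≠ 0) {s : K} {J : Matrix (Fin 3) (Fin 3) K} {u₀ h : ↥(unitaryGroupOfForm σ J)}
    (hnil : IsNilpotent (((u₀ : GL (Fin 3) K) : Matrix (Fin 3) (Fin 3) K) - 1))
    (hmat : (((h * u₀ * h⁻¹ : ↥(unitaryGroupOfForm σ J)) : GL (Fin 3) K) : Matrix (Fin 3) (Fin 3) K) =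
      cayley (s • ((((u₀ : GL (Fin 3) K) : Matrix (Fin 3) (Fin 3) K) - 1) * (((u₀ : GL (Fin 3) K) : Matrix (Fin 3) (Fin 3) K) + 1)⁻¹))) :
    ((h : GL (Fin 3) K) : Matrix (Fin 3) (Fin 3) K) *
        ((((u₀ : GL (Fin 3) K) : Matrix (Fin 3) (Fin 3) K) - 1) * (((u₀ : GL (Fin 3) K) : Matrix (Fin 3) (Fin 3) K) + 1)⁻¹) *
        (((h : GL (Fin 3) K)⁻¹ : GL (Fin 3) K) : Matrix (Fin 3) (Fin 3) K) =
      s • ((((u₀ : GL (Fin 3) K) : Matrix (Fin 3) (Fin 3) K) - 1) * (((u₀ : GL (Fin 3) K) : Matrix (Fin 3) (Fin 3) K) + 1)⁻¹) := by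
  have h2u : IsUnit (2 : K) := isUnit_iff_ne_zero.2 h2
  have hP : IsUnit ((((u₀ : GL (Fin 3) K) : Matrix (Fin 3) (Fin 3) K)) + 1).det := isUnit_det_add_one_of_isNilpotent h2 hnil
  have hm : IsUnit (1 - s • ((((u₀ : GL (Fin 3) K) : Matrix (Fin 3) (Fin 3) K) - 1) * (((u₀ : GL (Fin 3) K) : Matrix (Fin 3) (Fin 3) K) + 1)⁻¹)).det :=
    (Matrix.isUnit_iff_isUnit_det _).1 ((isNilpotent_inverseWindow hP hnil).smul s).isUnit_one_sub
  have hconj : ((h * u₀ * h⁻¹ : ↥(unitaryGroupOfForm σ J)) : GL (Fin 3) K) = (h : GL (Fin 3) K) * (u₀ : GL (Fin 3) K) * (h : GL (Fin 3) K)⁻¹ := rfl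
  have key := inverseWindow_conj (h : GL (Fin 3) K) hP
  rw [← Units.val_mul, ← Units.val_mul, ← hconj, hmat, inverseWindow_cayley h2u hm] at key
  exact key.symm

end PsiFree

end Summit.HodgeConjecture.HodgeConjecture.Cruxes.H413.K2E3UnipotentOrbitalScalingRegular

end
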